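import Mathlib
import Literature.Barriers.ValiantsHypothesis.MonotoneGapDecomposition
import Literature.Computability.AlgebraicComplexity.ArithCircuitProofs
import Summits.ValiantsHypothesis.ValiantsHypothesis.Theorems.DivisionGapPerMultiplesHardStubTypedDecompositionLL
import Summits.ValiantsHypothesis.ValiantsHypothesis.Theorems.DivisionGapPerMultiplesHardStubRectangleBound

/-!
# `DivisionGap.PerMultiplesHard` (stmt-ValiantsHypothesis-5068), line `uncharged-face-walk`:
the generic rectangle engine in the MASS grading (stub `stub_massRectangleBound`)

A nonzero torus-homogeneous `g ∈ ℝ≥0[x_ij]` (`n × n` variables; all monomials have row margins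
`R` and column margins `C`) of total degree `d = Σ i, R i ≥ 3` contains a single typed
"rectangle" `supp (a · b) ⊆ supp g` carrying a `1 / L(g)` fraction of the monomials of `g`
(`#supp g ≤ L(g) · #supp a · #supp b`, `L = complexity`), with `a ≠ 0`, `b ≠ 0`, `L(a) ≤ L(g)`,
`L(b) ≤ 8 L(g) + 8`, and `a` torus-homogeneous with margins `(ρ, γ)` whose MASS `Σ i, ρ i`
(the total degree of `a`) lies in the Jerrum–Snir window `d < 3 · Σ ρ ≤ 2d`. The window is
located by total degree, not by row support, so no homogenisation / degree charge is paid.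

Proof: verbatim the landed two-sided typed decomposition
`TypedDecompositionLL.exists_typed_list_LL`
(`Theorems/DivisionGapPerMultiplesHardStubTypedDecompositionLL.lean`) with the abstract descent
`TypedDecomposition.exists_window_operand` run on the measure `MvPolynomial.totalDegree`
(subadditive under `+`, `*`, scalars; `1` on variables, `0` on constants) and `N = d`: the output
has degree `d` and `2d < 3d`, so some gate value `p_v` has `d < 3 deg p_v ≤ 2d`; peel it with the
link circuit (`LinkCircuit.exists_linkCircuit`, cost of the complement `≤ 8 S + 8`), type `p_v`
through `supp (p_v · b) ⊆ supp g` (`exists_margins_of_support_mul_subset`), and note that a typed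
`a ≠ 0` with margins `ρ` is homogeneous of degree `Σ ρ` (`isHomogeneous_of_margins`). The
rectangle is the maximising summand (`RectangleBound.exists_rectangle_of_eq_sum`).

-- adapted from DivisionGapPerMultiplesHardStubTypedDecompositionLL.lean and
-- DivisionGapPerMultiplesHardStubRectangleBound.lean
-/

noncomputable section

-- the namespace is mandated by the crux (`Summit.ValiantsHypothesis.ValiantsHypothesis.…`)
set_option linter.dupNamespace false

open MvPolynomial Literature.Computability.AlgebraicComplexity
open scoped NNReal BigOperators
open Literature.Barriers.ValiantsHypothesis
open Literature.Computability.AlgebraicComplexity.ArithCircuit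
open Summit.ValiantsHypothesis.ValiantsHypothesis.Theorems.DivisionGap.PerMultiplesHard.TypedDecomposition
open Summit.ValiantsHypothesis.ValiantsHypothesis.Theorems.DivisionGap.PerMultiplesHard.TypedDecompositionL
open Summit.ValiantsHypothesis.ValiantsHypothesis.Theorems.DivisionGap.PerMultiplesHard.LinkCircuit
open Summit.ValiantsHypothesis.ValiantsHypothesis.Theorems.DivisionGap.PerMultiplesHard.RectangleBound

namespace Summit.ValiantsHypothesis.ValiantsHypothesis.Theorems.DivisionGap.PerMultiplesHard.MassRectangleBound

variable {n : ℕ}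

/-- A typed polynomial is homogeneous: if every monomial of `p` has the row margins `ρ`, then
`p` is homogeneous of total degree `Σ i, ρ i` (the degree of a monomial `m` is
`Σ_{(i,j)} m (i, j) = Σ i, Σ j, m (i, j) = Σ i, ρ i`). [folklore] -/
theorem isHomogeneous_of_margins {p : MvPolynomial (Fin n × Fin n) ℝ≥0} {ρ : Fin n → ℕ}
    (hp : ∀ m ∈ p.support, ∀ i, ∑ j, m (i, j) = ρ i) : p.IsHomogeneous (∑ i, ρ i) := by
  intro m hm
  have hdeg : Finsupp.weight (1 : Fin n × Fin n → ℕ) m = Finsupp.degree m := by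
    rw [Finsupp.degree_eq_weight_one]; rfl
  rw [hdeg, Finsupp.degree_eq_sum, Fintype.sum_prod_type]
  exact Finset.sum_congr rfl fun i _ => hp m (mem_support_iff.mpr hm) i

/-- The total degree of a nonzero typed polynomial is its mass: if every monomial of `p ≠ 0` has
the row margins `ρ`, then `deg p = Σ i, ρ i`. [folklore] -/
theorem totalDegree_eq_of_margins {p : MvPolynomial (Fin n × Fin n) ℝ≥0} {ρ : Fin n → ℕ}
    (hp : ∀ m ∈ p.support, ∀ i, ∑ j, m (i, j) = ρ i) (h0 : p ≠ 0) :
    p.totalDegree = ∑ i, ρ i :=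
  (isHomogeneous_of_margins hp).totalDegree h0

/-- **A gate in the degree window.** If a fan-in-two circuit over `ℝ≥0` computes a nonzero
polynomial in the `n × n` variables all of whose monomials have the row margins `R` with
`d = Σ i, R i ≥ 3`, then some gate value `p` has `d < 3 deg p ≤ 2d`: the output has degree `d`
(`3d > 2d`) and the descent `exists_window_operand` applies to the total degree (subadditive,
`deg xᵢⱼ = 1 ≤ d / 3`, `deg c = 0`). [cite: JerrumSnir1982, §3.3 (proof of Thm. 3.4)] -/
theorem exists_degree_window_gate (n : ℕ) (R : Fin n → ℕ) (hR : 3 ≤ ∑ i, R i)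
    (P : ArithCircuit ℝ≥0 (Fin n × Fin n)) (h2 : P.IsFanInTwo)
    (hg : ∀ m ∈ P.eval.support, ∀ i, ∑ j, m (i, j) = R i) (h0 : P.eval ≠ 0) :
    ∃ v : ℕ, (∑ i, R i) < 3 * ((gateValues P.gates).getD v 0).totalDegree ∧
      3 * ((gateValues P.gates).getD v 0).totalDegree ≤ 2 * ∑ i, R i := by
  have hdeg : P.eval.totalDegree = ∑ i, R i := totalDegree_eq_of_margins hg h0
  have hout : 2 * (∑ i, R i) < 3 * P.eval.totalDegree := by rw [hdeg]; omega
  exact exists_window_operand P.gates h2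
    (fun p : MvPolynomial (Fin n × Fin n) ℝ≥0 => p.totalDegree) (∑ i, R i)
    (fun p q => (totalDegree_add p q).trans (max_le (Nat.le_add_right _ _) (Nat.le_add_left _ _)))
    totalDegree_mul totalDegree_smul_le
    (fun e => by rw [totalDegree_X]; omega) totalDegree_C P.output hout

/-- **The peeling induction in the mass grading, with BOTH cost bounds.** A fan-in-two circuit
over `ℝ≥0` of size `≤ S` whose gate values vanish outside a set `Z` of at most `N` indices and
whose output is typed with margins `(R, C)`, `d = Σ i, R i ≥ 3`, writes its output as a sum of
at most `N` products `a · b`, every `a` of complexity `≤ S` and typed with margins `(ρ, γ)` of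
mass `Σ ρ` in the window `d < 3 Σ ρ ≤ 2d`, and every `b` of complexity `≤ 8 S + 8`: zero a
degree-window gate `v` (`exists_degree_window_gate`), whose value `a = p_v` is computed by
`⟨P.gates, .gate v⟩` of size `≤ S` and whose complement `b = Q.eval` is computed by the link
circuit `Q` of size `≤ 8 · P.size + 8` (`exists_linkCircuit`), type `p_v` through
`supp (p_v · b) ⊆ supp P.eval` when `b ≠ 0` (then `deg p_v = Σ ρ`), and recurse on `P.zeroAt v`
(same size). [cite: JerrumSnir1982, §3 (Lemma 3.1(iii), Thm. 3.2)] -/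
theorem exists_typed_list_mass (n : ℕ) (R C : Fin n → ℕ) (hR : 3 ≤ ∑ i, R i) (S : ℕ) :
    ∀ (N : ℕ) (P : ArithCircuit ℝ≥0 (Fin n × Fin n)), P.IsFanInTwo → P.size ≤ S →
      (∃ Z : Finset ℕ, Z.card ≤ N ∧ ∀ j ∉ Z, (gateValues P.gates).getD j 0 = 0) →
      (∀ m ∈ P.eval.support, (∀ i, ∑ j, m (i, j) = R i) ∧ (∀ j, ∑ i, m (i, j) = C j)) →
      ∃ L : List (MvPolynomial (Fin n × Fin n) ℝ≥0 × MvPolynomial (Fin n × Fin n) ℝ≥0),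
        L.length ≤ N ∧ P.eval = (L.map fun ab => ab.1 * ab.2).sum ∧
        ∀ ab ∈ L, complexity ab.1 ≤ S ∧ complexity ab.2 ≤ 8 * S + 8 ∧ ∃ ρ γ : Fin n → ℕ,
          (∀ m ∈ ab.1.support, (∀ i, ∑ j, m (i, j) = ρ i) ∧ (∀ j, ∑ i, m (i, j) = γ j)) ∧
          (∑ i, R i) < 3 * (∑ i, ρ i) ∧ 3 * (∑ i, ρ i) ≤ 2 * (∑ i, R i) := by
  intro N
  induction N with
  | zero =>
    rintro P h2 - ⟨Z, hZc, hZ0⟩ hg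
    by_cases h0 : P.eval = 0
    · exact ⟨[], le_rfl, by simp [h0], by simp⟩
    · exfalso
      obtain ⟨v, hlo, -⟩ :=
        exists_degree_window_gate n R hR P h2 (fun m hm => (hg m hm).1) h0
      have hv : (gateValues P.gates).getD v 0 = 0 :=
        hZ0 v (by simp [Finset.card_eq_zero.mp (Nat.le_zero.mp hZc)])
      rw [hv, totalDegree_zero] at hlo
      omega
  | succ N ih =>
    rintro P h2 hS ⟨Z, hZc, hZ0⟩ hg
    by_cases h0 : P.eval = 0
    · exact ⟨[], by simp, by simp [h0], by simp⟩
    obtain ⟨v, hlo, hhi⟩ :=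
      exists_degree_window_gate n R hR P h2 (fun m hm => (hg m hm).1) h0
    -- the complement of the peel at `v` is computed by the link circuit `Q`, fan-in-two of size
    -- `≤ 8 · P.size + 8 ≤ 8 S + 8`
    obtain ⟨Q, hQ2, hQsize, hq⟩ := exists_linkCircuit P v h2
    have hcostb : complexity Q.eval ≤ 8 * S + 8 :=
      (complexity_le_size hQ2 rfl).trans (hQsize.trans (by omega))
    have hlink := linked_gateValues_set P.gates v
    -- the value of gate `v` is computed by `⟨P.gates, .gate v⟩`, fan-in-two of size `P.size ≤ S`
    have hcost : complexity ((gateValues P.gates).getD v 0) ≤ S :=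
      (complexity_le_size (P := ⟨P.gates, .gate v⟩) h2 rfl).trans hS
    set p := (gateValues P.gates).getD v 0
    set q := Q.eval
    have hp0 : p ≠ 0 := by
      intro h
      rw [h, totalDegree_zero] at hlo
      omega
    have hvZ : v ∈ Z := by_contra fun h => hp0 (hZ0 v h)
    -- the zeroed circuit: same size, values vanish outside `Z.erase v`, output still typed
    have hS' : (P.zeroAt v).size ≤ S := (size_zeroAt P v).trans_le hS
    have hZ' : ∃ Z' : Finset ℕ, Z'.card ≤ N ∧
        ∀ j ∉ Z', (gateValues (P.zeroAt v).gates).getD j 0 = 0 := by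
      refine ⟨Z.erase v, ?_, fun j hj => ?_⟩
      · rw [Finset.card_erase_of_mem hvZ]; omega
      · by_cases hjv : j = v
        · subst hjv; exact getD_gateValues_set_zeroGate P.gates j
        · have hjZ : j ∉ Z := fun h => hj (Finset.mem_erase.mpr ⟨hjv, h⟩)
          obtain ⟨h, hh⟩ := hlink.2 j
          rw [hZ0 j hjZ] at hh
          exact eq_zero_of_zero_eq_add hh
    have hg' : ∀ m ∈ (P.zeroAt v).eval.support,
        (∀ i, ∑ j, m (i, j) = R i) ∧ (∀ j, ∑ i, m (i, j) = C j) :=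
      fun m hm => hg m (support_subset_of_eq_add hq hm)
    obtain ⟨L, hLlen, hLsum, hLtyp⟩ := ih (P.zeroAt v) (h2.zeroAt v) hS' hZ' hg'
    by_cases hq0 : q = 0
    · refine ⟨L, by omega, ?_, hLtyp⟩
      rw [hq, hq0, mul_zero, add_zero, hLsum]
    · have hsub : (p * q).support ⊆ P.eval.support :=
        support_subset_of_eq_add (hq.trans (add_comm _ _))
      obtain ⟨ρ, γ, hty⟩ := exists_margins_of_support_mul_subset hg hsub hq0
      have hdegp : p.totalDegree = ∑ i, ρ i :=
        totalDegree_eq_of_margins (fun m hm => (hty m hm).1) hp0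
      refine ⟨(p, q) :: L, by simpa using hLlen, ?_, ?_⟩
      · simp only [List.map_cons, List.sum_cons]
        rw [hq, hLsum, add_comm]
      · intro ab hab
        rcases List.mem_cons.mp hab with rfl | hab
        · refine ⟨hcost, hcostb, ρ, γ, hty, ?_⟩
          rw [← hdegp]
          exact ⟨hlo, hhi⟩
        · exact hLtyp ab hab

/-- **The two-sided typed decomposition in the mass grading.** A torus-homogeneous `g` over
`ℝ≥0` (all monomials have margins `(R, C)`) of total degree `d = Σ i, R i ≥ 3` writes as
`g = Σ_{t < s} a_t · b_t` with `s ≤ L(g)`, every `a_t` of complexity `L(a_t) ≤ L(g)` and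
torus-homogeneous with margins `(ρ, γ)`, `d < 3 · Σ ρ ≤ 2d`, and every `b_t` of complexity
`L(b_t) ≤ 8 L(g) + 8`: peel (`exists_typed_list_mass`) a minimal fan-in-two circuit for `g`
(`exists_computes_size_eq_complexity`) at most `size = L(g)` times; every circuit of the
peeling sequence has `L(g)` gates.
[cite: JerrumSnir1982, §3 (Lemma 3.1(iii), Thm. 3.2, proof of Thm. 3.4)] -/
theorem massDecomposition (n : ℕ) (g : MvPolynomial (Fin n × Fin n) ℝ≥0) (R C : Fin n → ℕ)
    (hg : ∀ m ∈ g.support, (∀ i, ∑ j, m (i, j) = R i) ∧ (∀ j, ∑ i, m (i, j) = C j))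
    (hR : 3 ≤ ∑ i, R i) :
    ∃ s : ℕ, s ≤ complexity g ∧
      ∃ a b : Fin s → MvPolynomial (Fin n × Fin n) ℝ≥0,
        g = ∑ t, a t * b t ∧
        ∀ t, complexity (a t) ≤ complexity g ∧ complexity (b t) ≤ 8 * complexity g + 8 ∧
          ∃ ρ γ : Fin n → ℕ,
          (∀ m ∈ (a t).support, (∀ i, ∑ j, m (i, j) = ρ i) ∧ (∀ j, ∑ i, m (i, j) = γ j)) ∧
          (∑ i, R i) < 3 * (∑ i, ρ i) ∧ 3 * (∑ i, ρ i) ≤ 2 * (∑ i, R i) := by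
  obtain ⟨P, h2, hPg, hsize⟩ := exists_computes_size_eq_complexity g
  have heval : P.eval = g := hPg
  subst heval
  have hZ : ∃ Z : Finset ℕ, Z.card ≤ P.size ∧ ∀ j ∉ Z, (gateValues P.gates).getD j 0 = 0 := by
    refine ⟨Finset.range P.size, by simp, fun j hj => getD_gateValues_eq_zero ?_⟩
    exact List.getElem?_eq_none_iff.mpr (by simpa [ArithCircuit.size] using hj)
  obtain ⟨L, hLlen, hLsum, hLtyp⟩ :=
    exists_typed_list_mass n R C hR (complexity P.eval) P.size P h2 hsize.le hZ hg
  refine ⟨L.length, hsize ▸ hLlen, fun t => (L[t.1]).1, fun t => (L[t.1]).2, ?_,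
    fun t => hLtyp _ (List.getElem_mem _)⟩
  rw [Fin.sum_univ_fun_getElem L (fun ab => ab.1 * ab.2)]
  exact hLsum

/-- **The generic rectangle engine in the mass grading** (registered stub
`stub_massRectangleBound`). For `1 ≤ n`, a nonzero torus-homogeneous `g` over `ℝ≥0` (all
monomials have margins `(R, C)`) of total degree `d = Σ i, R i ≥ 3` has a typed rectangle:
`a ≠ 0`, `b ≠ 0` with `L(a) ≤ L(g)`, `L(b) ≤ 8 L(g) + 8`, `supp (a · b) ⊆ supp g`,
`#supp g ≤ L(g) · #supp a · #supp b`, and `a` torus-homogeneous with margins `(ρ, γ)` of mass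
`Σ ρ` in the Jerrum–Snir window `d < 3 · Σ ρ ≤ 2d`: the maximising summand of the mass-graded
two-sided typed decomposition `massDecomposition`, by no cancellation over `ℝ≥0`
(`exists_rectangle_of_eq_sum`).
[cite: JerrumSnir1982, §3 (Lemma 3.1(iii), Thm. 3.2, proof of Thm. 3.4)] -/
theorem stub_massRectangleBound : ∀ (n : ℕ), 1 ≤ n →
    ∀ (g : MvPolynomial (Fin n × Fin n) ℝ≥0) (R C : Fin n → ℕ),
      (∀ m ∈ g.support, (∀ i, ∑ j, m (i, j) = R i) ∧ (∀ j, ∑ i, m (i, j) = C j)) →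
      3 ≤ ∑ i, R i → g ≠ 0 →
      ∃ a b : MvPolynomial (Fin n × Fin n) ℝ≥0, a ≠ 0 ∧ b ≠ 0 ∧
        complexity a ≤ complexity g ∧ complexity b ≤ 8 * complexity g + 8 ∧
        (a * b).support ⊆ g.support ∧
        g.support.card ≤ complexity g * (a.support.card * b.support.card) ∧
        ∃ ρ γ : Fin n → ℕ,
          (∀ m ∈ a.support, (∀ i, ∑ j, m (i, j) = ρ i) ∧ (∀ j, ∑ i, m (i, j) = γ j)) ∧
          (∑ i, R i) < 3 * (∑ i, ρ i) ∧ 3 * (∑ i, ρ i) ≤ 2 * (∑ i, R i) := by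
  intro n _hn g R C hg hR hg0
  obtain ⟨s, hsL, a, b, hsum, htyp⟩ := massDecomposition n g R C hg hR
  obtain ⟨t₀, ha0, hb0, hsub, hcard⟩ := exists_rectangle_of_eq_sum g a b hsum hg0
  obtain ⟨hca, hcb, ρ, γ, hty, hlo, hhi⟩ := htyp t₀
  exact ⟨a t₀, b t₀, ha0, hb0, hca, hcb, hsub,
    hcard.trans (Nat.mul_le_mul_right _ hsL), ρ, γ, hty, hlo, hhi⟩

end Summit.ValiantsHypothesis.ValiantsHypothesis.Theorems.DivisionGap.PerMultiplesHard.MassRectangleBound
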